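/-
HONEST FRAMING: certified error envelopes and provably optimal rounding/accumulation schemes for
low-precision formats under stated cost models; every table by two implementations; no hardware
or vendor claims.
-/
import Summits.Ventures.CertifiedArithmetic.LowPrec.OptDemotionRoutingTwoFamRatio
import Summits.Ventures.CertifiedArithmetic.LowPrec.OptDemotionRoutingTTLow

/-!
# The demotion law (Theorem T8), part 10e: the `O`/`E` ROWS of opt's split; all-`q` rows; a top-level reduction

opt's single-tree split of the two-tree inequality (gen13/README §4, gen15 §0): with one weight
`ρ_β ∈ [0, 1]` per level `β = 2^k`, the `O`-ROW `O(β, A, ρ)` of a tree `a`,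
`2 BR_a(o) ≤ (1+ρ) BR_a(o + β - ½) + (1-ρ) BR_a(o - β)` (`o = 2^(q-1) - β + A + ½`), and the
`E`-ROW `E(β, B, ρ)` of a tree `b`, `2 BR_b(e) ≤ (1-ρ) BR_b(e + β) + (1+ρ) BR_b(e - β + ½)`
(`e = β + B`), add up to the two-tree inequality at `(β, A, B)` (part 9d `tt_combine`).  THIS FILE
names the rows (`ORow`, `ERow`), restates R29 (part 10b) as **`TTlow_of_rows`**: `O`-rows for all
`A < β` and `E`-rows for all `B < β`, every level `k ≤ q - 2`, one `ρ_k ∈ [0,1]` per level ⟹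
`TTlow q` ⟹ Conjecture D for every tree (`conjectureD_of_rows`), and proves three all-`q` facts
about the e-side:
* `eRow_of_top` — A SUFFICIENT TOP-LEVEL REDUCTION: the row `E(2^k, B, ρ)` of a tree follows
  from its top-level row `E(2^(q-2), B · 2^(q-2-k), ρ)` (homogeneity, part 8j, and ONE use of
  monotonicity (M): `BR(2^s B + ½) ≤ BR(2^s (B + ½))`).  It is LOSSY: the (M) step gives away the
  difference between `B + ½` and `B + 2^-(s+1)`, and numerically (q = 6, opt's sample tables + deep
  doublings) the proxy rows need `ρ ≤ 1.1u–1.5u` while the genuine low-level rows allow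
  `ρ ≤ 2u–9u`; since the o-side floors exceed `u` at deep levels (opt R22/R25), the proxy is a
  tool for the levels just below the top, not a replacement for the per-level e-side;
* `eRow_zero` — the rows `E(2^k, 0, ρ)` hold for every tree whenever `ρ (2^(k+2) - 1) ≤ 1`, in
  particular at `ρ = u` for every level;
* `eRow_singleBit` — part 10c (R31): `E(2^k, 2^i, u)`, `i < k`, for every tree.
So at `ρ = u` the e-side targets left are the top-level offsets with at least two bits.  On the
o-side the one all-`q` row available is the top-level row with no offset, `O(2^(q-2), 0, ρ)` for
`ρ ≥ ρ_o = u(1-2u-u²)/(1-u³)` (part 10f, opt R21; `oRow_top_zero`); the other `O`-rows are open for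
general `q` (opt gen15 §7(2); their floors force `ρ_k > u` at low levels, R22/R25).
-/

namespace Summit.Ventures.CertifiedArithmetic.LowPrec.Opt

open Literature.ComputerArithmetic.JeannerodRump2018
open Literature.ComputerArithmetic.JeannerodRump2018.SumTree

/-! ## The rows -/

/-- THE `O`-ROW `O(β = 2^k, A, ρ)` of the tree `t` (budget units, `o = 2^(q-1) - β + A + ½`):
`2 BR_t(o) ≤ (1 + ρ) BR_t(o + β - ½) + (1 - ρ) BR_t(o - β)`. -/
def ORow (q : ℕ) (t : SumTree) (ρ : ℚ) (k A : ℕ) : Prop :=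
  2 * treeBRv q t ((2 : ℚ) ^ (q - 1) - (2 : ℚ) ^ k + A + 1 / 2) ≤
    (1 + ρ) * treeBRv q t ((2 : ℚ) ^ (q - 1) - (2 : ℚ) ^ k + A + 1 / 2 + (2 : ℚ) ^ k - 1 / 2) +
      (1 - ρ) * treeBRv q t ((2 : ℚ) ^ (q - 1) - (2 : ℚ) ^ k + A + 1 / 2 - (2 : ℚ) ^ k)

/-- THE `E`-ROW `E(β = 2^k, B, ρ)` of the tree `t` (budget units, `e = β + B`):
`2 BR_t(e) ≤ (1 - ρ) BR_t(e + β) + (1 + ρ) BR_t(e - β + ½)`. -/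
def ERow (q : ℕ) (t : SumTree) (ρ : ℚ) (k B : ℕ) : Prop :=
  2 * treeBRv q t ((2 : ℚ) ^ k + B) ≤
    (1 - ρ) * treeBRv q t ((2 : ℚ) ^ k + B + (2 : ℚ) ^ k) +
      (1 + ρ) * treeBRv q t ((2 : ℚ) ^ k + B - (2 : ℚ) ^ k + 1 / 2)

section Rows

variable {q : ℕ}

/-- **R29 BY ROWS**: one weight `ρ_k ∈ [0, 1]` per level, the `O`-rows for all `A < 2^k` and the
`E`-rows for all `B < 2^k` at every level `k ≤ q - 2`, for every tree ⟹ `TTlow q`. -/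
theorem TTlow_of_rows (rho : ℕ → ℚ) (h0 : ∀ k, k + 2 ≤ q → 0 ≤ rho k) (h1 : ∀ k, k + 2 ≤ q → rho k ≤ 1)
    (hO : ∀ (k : ℕ) (t : SumTree) (A : ℕ), k + 2 ≤ q → A < 2 ^ k → ORow q t (rho k) k A)
    (hE : ∀ (k : ℕ) (t : SumTree) (B : ℕ), k + 2 ≤ q → B < 2 ^ k → ERow q t (rho k) k B) :
    TTlow q := by
  intro a b k A B hk hA hB
  have kO := hO k a A hk hA
  have kE := hE k b B hk hB
  unfold ORow at kO
  unfold ERow at kE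
  simp only
  exact tt_combine (ρd := 1) (ρn := rho k) (by norm_num) (h1 k hk) (h0 k hk) (by linarith) (by linarith)

/-- **CONJECTURE D FOR EVERY TREE FROM THE ROWS** (parts 10a–10b + `TTlow_of_rows`, `q ≥ 2`). -/
theorem conjectureD_of_rows (hq : 2 ≤ q) (rho : ℕ → ℚ) (h0 : ∀ k, k + 2 ≤ q → 0 ≤ rho k)
    (h1 : ∀ k, k + 2 ≤ q → rho k ≤ 1)
    (hO : ∀ (k : ℕ) (t : SumTree) (A : ℕ), k + 2 ≤ q → A < 2 ^ k → ORow q t (rho k) k A)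
    (hE : ∀ (k : ℕ) (t : SumTree) (B : ℕ), k + 2 ≤ q → B < 2 ^ k → ERow q t (rho k) k B)
    {p : ℕ} (hp : 1 ≤ p) {emin : ℤ} {fl flp : ℚ → ℚ} (hfl : IsRoundNearest q emin fl)
    (hflp : IsRoundNearest p emin flp) (t : SumTree) (ht : ∀ x ∈ leaves t, IsFloat q emin x ∧ 0 ≤ x) :
    exact t ≤ treeQf (unitRoundoff q) t (unitRoundoff p) * flp (eval fl t) :=
  conjectureD_of_TTlow hp hq (TTlow_of_rows rho h0 h1 hO hE) hfl hflp t ht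

/-! ## Floats and routing values under scaling -/

/-- A scaled float is a float. -/
theorem IsQFloat.two_zpow_mul {x : ℚ} (hx : IsQFloat q x) (j : ℤ) : IsQFloat q ((2 : ℚ) ^ j * x) := by
  obtain ⟨S, hne, hS, rfl⟩ := hx
  exact ⟨S.image fun e => e + j, hne.image _, (routable_image_add_iff j S).2 hS, val_image_add j S⟩

/-- HOMOGENEITY BY VALUE: `BR_t(2^j x) = 2^j BR_t(x)` for a float `x`. -/
theorem treeBRv_two_zpow_mul (t : SumTree) {x : ℚ} (hx : IsQFloat q x) (j : ℤ) :
    treeBRv q t ((2 : ℚ) ^ j * x) = (2 : ℚ) ^ j * treeBRv q t x := by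
  obtain ⟨S, -, -, rfl⟩ := hx
  rw [← val_image_add, treeBRv_val, treeBRv_val, treeBR_image_add]

/-! ## Monotonicity of the rows in the weight -/

/-- The `E`-rows get HARDER as `ρ` grows: `E(β, B, ρ) ⟹ E(β, B, ρ')` for `ρ' ≤ ρ`
(`BR(e - β + ½) ≤ BR(e + β)` by (M); `q ≥ 1`, `k + 2 ≤ q`, `B < 2^k`). -/
theorem ERow.mono (hq : 1 ≤ q) {t : SumTree} {ρ ρ' : ℚ} {k B : ℕ} (hk : k + 2 ≤ q) (hB : B < 2 ^ k)
    (h : ERow q t ρ k B) (hρ : ρ' ≤ ρ) : ERow q t ρ' k B := by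
  unfold ERow at h ⊢
  have hkk : 2 ^ (k + 1) = 2 * 2 ^ k := by rw [pow_succ]; ring
  have hk1 : 2 ^ (k + 1) ≤ 2 ^ (q - 1) := Nat.pow_le_pow_right (by norm_num) (by omega)
  have hkq : 2 ^ (q - 1) + 2 ^ (q - 1) = 2 ^ q := (two_pow_eq_half_add_half hq).symm
  have e1 : (2 : ℚ) ^ k + B + (2 : ℚ) ^ k = ((2 ^ (k + 1) + B : ℕ) : ℚ) := by push_cast; ring
  have e2 : (2 : ℚ) ^ k + B - (2 : ℚ) ^ k + 1 / 2 = (B : ℚ) + 1 / 2 := by ring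
  have hM : treeBRv q t ((2 : ℚ) ^ k + B - (2 : ℚ) ^ k + 1 / 2) ≤
      treeBRv q t ((2 : ℚ) ^ k + B + (2 : ℚ) ^ k) := by
    rw [e1, e2]
    refine treeBRv_mono hq t (isQFloat_half hq (by omega)) (isQFloat_natCast (by omega) (by omega)) ?_
    have : (1 : ℚ) ≤ (2 : ℚ) ^ (k + 1) := one_le_pow₀ (by norm_num)
    push_cast; linarith
  nlinarith [hM, hρ]

/-- The `O`-rows get EASIER as `ρ` grows: `O(β, A, ρ) ⟹ O(β, A, ρ')` for `ρ ≤ ρ'`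
(`BR(o - β) ≤ BR(o + β - ½)` by (M); `q ≥ 1`, `k + 2 ≤ q`, `A < 2^k`). -/
theorem ORow.mono (hq : 1 ≤ q) {t : SumTree} {ρ ρ' : ℚ} {k A : ℕ} (hk : k + 2 ≤ q) (hA : A < 2 ^ k)
    (h : ORow q t ρ k A) (hρ : ρ ≤ ρ') : ORow q t ρ' k A := by
  unfold ORow at h ⊢
  have hkk : 2 ^ (k + 1) = 2 * 2 ^ k := by rw [pow_succ]; ring
  have hk1 : 2 ^ (k + 1) ≤ 2 ^ (q - 1) := Nat.pow_le_pow_right (by norm_num) (by omega)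
  have hkq : 2 ^ (q - 1) + 2 ^ (q - 1) = 2 ^ q := (two_pow_eq_half_add_half hq).symm
  have e1 : (2 : ℚ) ^ (q - 1) - (2 : ℚ) ^ k + A + 1 / 2 + (2 : ℚ) ^ k - 1 / 2 =
      ((2 ^ (q - 1) + A : ℕ) : ℚ) := by push_cast; ring
  have e2 : (2 : ℚ) ^ (q - 1) - (2 : ℚ) ^ k + A + 1 / 2 - (2 : ℚ) ^ k =
      ((2 ^ (q - 1) - 2 ^ (k + 1) + A : ℕ) : ℚ) + 1 / 2 := by
    push_cast [Nat.cast_sub hk1]; ring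
  have hM : treeBRv q t ((2 : ℚ) ^ (q - 1) - (2 : ℚ) ^ k + A + 1 / 2 - (2 : ℚ) ^ k) ≤
      treeBRv q t ((2 : ℚ) ^ (q - 1) - (2 : ℚ) ^ k + A + 1 / 2 + (2 : ℚ) ^ k - 1 / 2) := by
    rw [e1, e2]
    refine treeBRv_mono hq t (isQFloat_half hq (by omega)) (isQFloat_natCast (by omega) (by omega)) ?_
    push_cast [Nat.cast_sub hk1]
    have : (1 : ℚ) ≤ (2 : ℚ) ^ (k + 1) := one_le_pow₀ (by norm_num)
    linarith
  nlinarith [hM, hρ]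

/-! ## A top-level reduction for the e-rows -/

/-- **A SUFFICIENT TOP-LEVEL REDUCTION FOR THE E-ROWS** (cf. opt gen15 §7(3)): for `k + 2 ≤ q`,
`B < 2^k`, `ρ ≥ -1`, the top-level row `E(2^(q-2), B · 2^(q-2-k), ρ)` of a tree implies its row
`E(2^k, B, ρ)` — scale down by `2^(q-2-k)` (homogeneity) and raise `BR(2^s B + ½) ≤ BR(2^s (B + ½))`
by (M).  (Lossy: the genuine low-level rows are much easier than their top-level proxies.) -/
theorem eRow_of_top (hq : 2 ≤ q) {t : SumTree} {ρ : ℚ} {k B : ℕ} (hk : k + 2 ≤ q) (hB : B < 2 ^ k)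
    (hρ : -1 ≤ ρ) (htop : ERow q t ρ (q - 2) (B * 2 ^ (q - 2 - k))) : ERow q t ρ k B := by
  have hq1 : 1 ≤ q := by omega
  unfold ERow at htop ⊢
  set s : ℕ := q - 2 - k with hs
  set c : ℚ := (2 : ℚ) ^ (s : ℤ) with hc
  have hcpos : 0 < c := zpow_pos (by norm_num) _
  have hc1 : 1 ≤ c := one_le_zpow₀ (by norm_num) (by positivity)
  have hcs : (2 : ℚ) ^ s = c := by rw [hc, zpow_natCast]
  have hβ' : (2 : ℚ) ^ (q - 2) = c * (2 : ℚ) ^ k := by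
    rw [hc, zpow_natCast, ← pow_add]; congr 1; omega
  have hB' : ((B * 2 ^ s : ℕ) : ℚ) = c * B := by push_cast; rw [hcs]; ring
  -- the three top-level points
  have h1 : (2 : ℚ) ^ (q - 2) + ((B * 2 ^ s : ℕ) : ℚ) = c * ((2 : ℚ) ^ k + B) := by
    rw [hβ', hB']; ring
  have h2 : (2 : ℚ) ^ (q - 2) + ((B * 2 ^ s : ℕ) : ℚ) + (2 : ℚ) ^ (q - 2) =
      c * ((2 : ℚ) ^ k + B + (2 : ℚ) ^ k) := by rw [hβ', hB']; ring
  have h3 : (2 : ℚ) ^ (q - 2) + ((B * 2 ^ s : ℕ) : ℚ) - (2 : ℚ) ^ (q - 2) + 1 / 2 =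
      ((B * 2 ^ s : ℕ) : ℚ) + 1 / 2 := by ring
  rw [h2, h3, h1] at htop
  -- floats
  have hkk : 2 ^ (k + 1) = 2 * 2 ^ k := by rw [pow_succ]; ring
  have hk1 : 2 ^ (k + 1) ≤ 2 ^ (q - 1) := Nat.pow_le_pow_right (by norm_num) (by omega)
  have hkq : 2 ^ (q - 1) + 2 ^ (q - 1) = 2 ^ q := (two_pow_eq_half_add_half hq1).symm
  have hsk : 2 ^ s * 2 ^ k = 2 ^ (q - 2) := by rw [← pow_add]; congr 1; omega
  have hq2 : 2 ^ (q - 2) ≤ 2 ^ (q - 1) := Nat.pow_le_pow_right (by norm_num) (by omega)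
  have hBs : B * 2 ^ s < 2 ^ (q - 1) := by
    have : B * 2 ^ s < 2 ^ k * 2 ^ s := Nat.mul_lt_mul_of_pos_right hB (Nat.two_pow_pos s)
    rw [mul_comm (2 ^ k), hsk] at this
    omega
  have Fe : IsQFloat q ((2 : ℚ) ^ k + B) := by
    have : (2 : ℚ) ^ k + B = ((2 ^ k + B : ℕ) : ℚ) := by push_cast; ring
    rw [this]; exact isQFloat_natCast (by omega) (by omega)
  have Fe1 : IsQFloat q ((2 : ℚ) ^ k + B + (2 : ℚ) ^ k) := by
    have : (2 : ℚ) ^ k + B + (2 : ℚ) ^ k = ((2 ^ (k + 1) + B : ℕ) : ℚ) := by push_cast; ring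
    rw [this]; exact isQFloat_natCast (by omega) (by omega)
  have Fh : IsQFloat q ((B : ℚ) + 1 / 2) := isQFloat_half hq1 (by omega)
  have Fh' : IsQFloat q (((B * 2 ^ s : ℕ) : ℚ) + 1 / 2) := isQFloat_half hq1 hBs
  -- homogeneity and the one (M) step
  rw [treeBRv_two_zpow_mul t Fe, treeBRv_two_zpow_mul t Fe1] at htop
  have hM : treeBRv q t (((B * 2 ^ s : ℕ) : ℚ) + 1 / 2) ≤ treeBRv q t (c * ((B : ℚ) + 1 / 2)) := by
    refine treeBRv_mono hq1 t Fh' (Fh.two_zpow_mul _) ?_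
    rw [hB']; nlinarith
  rw [treeBRv_two_zpow_mul t Fh] at hM
  have e2 : (2 : ℚ) ^ k + B - (2 : ℚ) ^ k + 1 / 2 = (B : ℚ) + 1 / 2 := by ring
  rw [e2]
  have hρ1 : 0 ≤ 1 + ρ := by linarith
  have hM' := mul_le_mul_of_nonneg_left hM hρ1
  have key : c * (2 * treeBRv q t ((2 : ℚ) ^ k + B)) ≤
      c * ((1 - ρ) * treeBRv q t ((2 : ℚ) ^ k + B + (2 : ℚ) ^ k) +
        (1 + ρ) * treeBRv q t ((B : ℚ) + 1 / 2)) := by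
    nlinarith [htop, hM']
  exact le_of_mul_le_mul_left key hcpos

/-! ## The e-rows with no offset bit, and the single-bit rows -/

/-- **THE ROWS `E(2^k, 0, ρ)`** hold for every tree exactly when `ρ (2^(k+2) - 1) ≤ 1` (or
`μ_t = 0`) — so at `ρ = u = 2^-q` for every level `k ≤ q - 2`: all three points are single bits,
`u · BR_t{e} = 2^e μ_t` (part 8a′). -/
theorem eRow_zero (hq : 1 ≤ q) (t : SumTree) {ρ : ℚ} {k : ℕ}
    (hρ : ρ * (2 ^ (k + 2) - 1) ≤ 1) : ERow q t ρ k 0 := by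
  unfold ERow
  have e1 : (2 : ℚ) ^ k + ((0 : ℕ) : ℚ) = val ({(k : ℤ)} : Finset ℤ) := by
    unfold val; rw [Finset.sum_singleton, zpow_natCast]; simp
  have e2 : (2 : ℚ) ^ k + ((0 : ℕ) : ℚ) + (2 : ℚ) ^ k = val ({(k : ℤ) + 1} : Finset ℤ) := by
    unfold val; rw [Finset.sum_singleton, zpow_add_one₀ (by norm_num), zpow_natCast]; simp; ring
  have e3 : (2 : ℚ) ^ k + ((0 : ℕ) : ℚ) - (2 : ℚ) ^ k + 1 / 2 = val ({(-1 : ℤ)} : Finset ℤ) := by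
    unfold val; rw [Finset.sum_singleton, zpow_neg_one]; simp
  rw [e2, e3, e1, treeBRv_val, treeBRv_val, treeBRv_val]
  have hu : 0 < unitRoundoff q := by unfold unitRoundoff; positivity
  have s1 := treeBR_singleton hq t (k : ℤ)
  have s2 := treeBR_singleton hq t ((k : ℤ) + 1)
  have s3 := treeBR_singleton hq t (-1 : ℤ)
  have hμ : 0 ≤ treeM (unitRoundoff q) t - 1 := by linarith [one_le_treeM (unitRoundoff_nonneg q) t]
  have hpk : (0 : ℚ) < (2 : ℚ) ^ (k : ℤ) := zpow_pos (by norm_num) _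
  have e4 : (2 : ℚ) ^ ((k : ℤ) + 1) = 2 * (2 : ℚ) ^ (k : ℤ) := by
    rw [zpow_add_one₀ (by norm_num)]; ring
  have e5 : (2 : ℚ) ^ (-1 : ℤ) = 1 / 2 := by norm_num
  rw [e4] at s2
  rw [e5] at s3
  -- ρ (2^(k+2) - 1) ≤ 1 with 2^(k+2) = 4 · 2^k
  have hρ' : ρ * (4 * (2 : ℚ) ^ (k : ℤ) - 1) ≤ 1 := by
    have : (2 : ℚ) ^ (k + 2) = 4 * (2 : ℚ) ^ (k : ℤ) := by rw [zpow_natCast, pow_add]; ring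
    rwa [this] at hρ
  have key : unitRoundoff q * (2 * treeBR q t {(k : ℤ)}) ≤
      unitRoundoff q * ((1 - ρ) * treeBR q t {(k : ℤ) + 1} + (1 + ρ) * treeBR q t {(-1 : ℤ)}) := by
    have eL : unitRoundoff q * (2 * treeBR q t {(k : ℤ)}) = 2 * (unitRoundoff q * treeBR q t {(k : ℤ)}) := by
      ring
    have eR : unitRoundoff q * ((1 - ρ) * treeBR q t {(k : ℤ) + 1} + (1 + ρ) * treeBR q t {(-1 : ℤ)}) =
        (1 - ρ) * (unitRoundoff q * treeBR q t {(k : ℤ) + 1}) +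
          (1 + ρ) * (unitRoundoff q * treeBR q t {(-1 : ℤ)}) := by ring
    rw [eL, eR, s1, s2, s3]
    have h1 : 0 ≤ (treeM (unitRoundoff q) t - 1) * (1 + ρ - 4 * ρ * (2 : ℚ) ^ (k : ℤ)) :=
      mul_nonneg hμ (by nlinarith)
    nlinarith [h1, hμ, hpk]
  exact le_of_mul_le_mul_left key hu

/-- `E(2^k, 0, u)` for every tree and every level `k ≤ q - 2`. -/
theorem eRow_zero_u (hq : 1 ≤ q) (t : SumTree) {k : ℕ} (hk : k + 2 ≤ q) :
    ERow q t (unitRoundoff q) k 0 := by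
  refine eRow_zero hq t ?_
  unfold unitRoundoff
  have h2 : (2 : ℚ) ^ (k + 2) ≤ (2 : ℚ) ^ q := pow_le_pow_right₀ (by norm_num) hk
  have hq0 : (0 : ℚ) < (2 : ℚ) ^ q := by positivity
  rw [div_mul_eq_mul_div, one_mul, div_le_one hq0]
  linarith

/-- **THE TOP-LEVEL `O`-ROW WITH NO OFFSET** `O(2^(q-2), 0, ρ)` for every tree, whenever
`u (1 - 2u - u²) ≤ ρ (1 - u³)` (part 10f, opt R21's corollary with the exact constant `ρ_o`). -/
theorem oRow_top_zero (hq : 2 ≤ q) (t : SumTree) {ρ : ℚ}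
    (hρ : unitRoundoff q * (1 - 2 * unitRoundoff q - unitRoundoff q ^ 2) ≤ ρ * (1 - unitRoundoff q ^ 3)) :
    ORow q t ρ (q - 2) 0 :=
  treeBRv_oRow_top_zero hq t hρ

/-- `O(2^(q-2), 0, u)` for every tree (`q ≥ 2`). -/
theorem oRow_top_zero_u (hq : 2 ≤ q) (t : SumTree) : ORow q t (unitRoundoff q) (q - 2) 0 :=
  treeBRv_oRow_top_zero_u hq t

/-- **THE SINGLE-BIT ROWS `E(2^k, 2^i, u)`**, `i < k ≤ q - 2`, for every tree (part 10c, R31). -/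
theorem eRow_singleBit (hq : 3 ≤ q) (t : SumTree) {k i : ℕ} (hk : k + 2 ≤ q) (hik : i < k) :
    ERow q t (unitRoundoff q) k (2 ^ i) := by
  have h := treeBRv_eRow_singleBit hq hk hik t
  unfold ERow
  simpa using h

end Rows

end Summit.Ventures.CertifiedArithmetic.LowPrec.Opt
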